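import Literature.NumberTheory.EllipticCurves.TwoAdicImageSurjectivityModTwoProofs
import Literature.NumberTheory.EllipticCurves.DivisionField
import Literature.NumberTheory.EllipticCurves.Rank1Residual.Predicates
import Mathlib.FieldTheory.IntermediateField.Adjoin.Basic
import Mathlib.FieldTheory.Minpoly.Field
import Mathlib.Algebra.Polynomial.SpecificDegree
import Mathlib.GroupTheory.Perm.Sign
import HarnessLib

/-!
# Stub `stub_resolventOfDivisionFieldTwo` of line `resolvent-elliptic-units` of the crux `SignedMuSeedAtTwoPlus`
# (stmt-BirchSwinnertonDyer-21438 = `stub_residualSeedAtTwo` of Kμ⁺ stmt-BirchSwinnertonDyer-20689 BY NAME,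
# route `ResidualThetaTransportAtTwo`) — PROVED: the RESOLVENT `ℚ(√Δ_W) ≤ ℚ(W[2])`, imaginary quadratic when `Δ_W < 0`,
# over which `ℚ(W[2])` is abelian (width seat bsd-wall-rtt-p4-w3 g6; `--supports stmt-BirchSwinnertonDyer-21438`; closes nothing)

HONEST FRAMING. THEOREMS ONLY (no `def`, no named fact, no `sorry`); BSD is not proved by any of this. The file proves the
registered stub `stub_resolventOfDivisionFieldTwo : ResolventOfDivisionFieldTwo` of
`Cruxes/SignedMuSeedAtTwoPlus/Lines/resolvent_elliptic_units.lean` (skeleton of record of 21438, sha acdb2e2ad61c) with the line's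
local `def ResolventOfDivisionFieldTwo` UNFOLDED verbatim; of its habitat⁺ hypotheses only `Δ_W < 0` is used.

Mechanism (Dokchitser–Dokchitser 2012, proof of the Theorem: «`ℚ(E[2]) ⊃ ℚ(√Δ)`»; tree file
`TwoTorsionGaloisActionProofs` / `TwoAdicImageSurjectivityModTwoProofs`, namespace `DokchitserDokchitser2012`): with
`δ = (x₀−x₁)(x₀−x₂)(x₁−x₂)` the difference product of the abscissae of the nonzero `2`-torsion points, `Δ = 16δ²`
(`algebraMap_Δ`) and `σδ = sign(σ|_{E[2]})·δ` (`smul_delta`).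
* `§1` `delta_mem_divisionField` — `δ ∈ ℚ(W[2])` (an automorphism fixing `E[2]` pointwise induces the identity permutation);
  `sign_permGal_eq_one_of_smul_delta` — `σδ = δ ⇒ σ` is EVEN on `{T₀, T₁, T₂}`.
* `§2` `perm_fin_three_comm_of_sign_eq_one` — even permutations of three letters commute (`A₃ = C₃`; `decide`);
  `smul_eq_self_of_permGal_eq_one` — `σ` with trivial permutation fixes `E[2]` pointwise.
* `§3` the resolvent `K_W = ℚ(4δ) = ℚ(√Δ_W)`: `finrank_resolvent_eq_two` (`X² − Δ_W` has no rational root when `Δ_W < 0`),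
  `isEmpty_ringHom_resolvent_real` (no real embedding: `(4δ)² = Δ_W < 0`).
* `§4` `resolventOfDivisionFieldTwo` — the stub VERBATIM: `ℚ(W[2])/ℚ` finite Galois (tree instances), `K_W ≤ ℚ(W[2])` quadratic
  imaginary, and any two automorphisms of `ℚ(W[2])` fixing `K_W` commute (they are even on the three letters, and the action on
  `E[2]` is faithful: `absRestrictNormalHom_divisionField_eq_one_iff`).

References: [DokchitserDokchitserMathZ2012] Theorem (1), proof; [SilvermanAEC2009] III.§1, III.§7, VIII.§1; [Serre1972] §5.3 (image in
`GL₂(𝔽₂) ≅ S₃`).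
-/

set_option autoImplicit false
-- D-0017: single-problem summit, so `Summit.BirchSwinnertonDyer.BirchSwinnertonDyer.…` repeats a namespace BY DESIGN.
set_option linter.dupNamespace false

noncomputable section

open scoped Classical Polynomial IntermediateField

open Polynomial WeierstrassCurve Field Literature.NumberTheory.EllipticCurves Literature.NumberTheory.GaloisRepresentations
  Literature.NumberTheory.EllipticCurves.DokchitserDokchitser2012 Literature.NumberTheory.EllipticCurves.Rank1Residual

namespace Summit.BirchSwinnertonDyer.BirchSwinnertonDyer.Theorems.SignedMuAtTwo.ResolventEllipticUnits

universe u

section General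

variable {K : Type u} [Field K] (W : WeierstrassCurve K) [W.IsElliptic] (h2 : (2 : K) ≠ 0)

/-! ## §1. `δ ∈ K(E[2])`; `σδ = δ` forces an even permutation -/

/-- An automorphism fixing `E[2]` pointwise induces the identity permutation of `{T₀, T₁, T₂}`.
[cite: SilvermanAEC2009, III.§7 (the representation G_{K̄/K} → Aut(E[m]))] -/
theorem permGal_eq_one_of_forall_smul_eq (σ : absoluteGaloisGroup K) (hσ : ∀ T : geomTorsion W 2, σ • T = T) :
    permGal W h2 σ = 1 := by
  ext i : 1
  apply T_injective W h2
  rw [T_permGal, hσ, Equiv.Perm.one_apply]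

/-- An automorphism inducing the identity permutation of `{T₀, T₁, T₂}` fixes `E[2] = {O, T₀, T₁, T₂}` pointwise.
[cite: SilvermanAEC2009, Cor. III.6.4(b) (E[m] ≅ ℤ/mℤ × ℤ/mℤ)] -/
theorem smul_eq_self_of_permGal_eq_one {σ : absoluteGaloisGroup K} (hσ : permGal W h2 σ = 1) (P : geomTorsion W 2) :
    σ • P = P := by
  rcases eq_zero_or_eq_T W h2 P with rfl | ⟨i, rfl⟩
  · exact smul_zero σ
  · rw [← T_permGal, hσ, Equiv.Perm.one_apply]

/-- **`δ ∈ K(E[2])`** («`ℚ(E[2]) ⊃ ℚ(√Δ)`»): an automorphism fixing `E[2]` pointwise is even on the three letters, hence fixes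
`δ = (x₀−x₁)(x₀−x₂)(x₁−x₂)`. [cite: DokchitserDokchitserMathZ2012, Theorem (1), proof (ℚ(E[2]) ⊃ ℚ(√Δ))] -/
theorem delta_mem_divisionField : delta W h2 ∈ W.divisionField 2 := by
  rw [mem_divisionField_iff]
  intro σ hσ
  have hσ' : ∀ T : geomTorsion W 2, σ • T = T := fun T ↦ by exact_mod_cast hσ T
  rw [smul_delta, permGal_eq_one_of_forall_smul_eq W h2 σ hσ', Equiv.Perm.sign_one, Units.val_one, Int.cast_one, one_mul]

/-- **`σδ = δ ⇒ σ` is even on `{T₀, T₁, T₂}`** (`δ ≠ 0`, `2 ≠ 0`). [cite: DokchitserDokchitserMathZ2012, Theorem (1), proof] -/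
theorem sign_permGal_eq_one_of_smul_delta {σ : absoluteGaloisGroup K} (hσ : σ • delta W h2 = delta W h2) :
    Equiv.Perm.sign (permGal W h2 σ) = 1 := by
  rcases Int.units_eq_one_or (Equiv.Perm.sign (permGal W h2 σ)) with h | h
  · exact h
  · exfalso
    rw [smul_delta, h, Units.val_neg, Units.val_one, Int.cast_neg, Int.cast_one, neg_mul, one_mul] at hσ
    have h2' : (2 : AlgebraicClosure K) ≠ 0 := by
      rw [show (2 : AlgebraicClosure K) = algebraMap K (AlgebraicClosure K) 2 from (map_ofNat _ 2).symm]
      exact (_root_.map_ne_zero _).mpr h2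
    apply mul_ne_zero h2' (delta_ne_zero W h2)
    linear_combination -hσ

/-! ## §2. Even permutations of three letters commute -/

omit [W.IsElliptic] in
/-- `A₃` is abelian: two EVEN permutations of three letters commute. [folklore] -/
theorem perm_fin_three_comm_of_sign_eq_one :
    ∀ p q : Equiv.Perm (Fin 3), Equiv.Perm.sign p = 1 → Equiv.Perm.sign q = 1 → p * q = q * p := by
  decide

/-- Two automorphisms that are even on `{T₀, T₁, T₂}` have a commutator acting trivially on `E[2]`.
[cite: SilvermanAEC2009, III.§7 (the representation G_{K̄/K} → Aut(E[m]))] -/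
theorem commutator_smul_eq_self_of_sign_eq_one {σ τ : absoluteGaloisGroup K}
    (hσ : Equiv.Perm.sign (permGal W h2 σ) = 1) (hτ : Equiv.Perm.sign (permGal W h2 τ) = 1) (P : geomTorsion W 2) :
    (σ * τ * σ⁻¹ * τ⁻¹) • P = P := by
  apply smul_eq_self_of_permGal_eq_one W h2
  have hcomm := perm_fin_three_comm_of_sign_eq_one _ _ hσ hτ
  have hinvσ : permGal W h2 σ⁻¹ = (permGal W h2 σ)⁻¹ :=
    eq_inv_of_mul_eq_one_left (by rw [← permGal_mul, inv_mul_cancel, permGal_one])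
  have hinvτ : permGal W h2 τ⁻¹ = (permGal W h2 τ)⁻¹ :=
    eq_inv_of_mul_eq_one_left (by rw [← permGal_mul, inv_mul_cancel, permGal_one])
  rw [permGal_mul, permGal_mul, permGal_mul, hinvσ, hinvτ, hcomm, mul_inv_cancel_right, mul_inv_cancel]

end General

/-! ## §3. The resolvent field `ℚ(√Δ_W) = ℚ(4δ)` for `Δ_W < 0` -/

section Resolvent

variable (W : WeierstrassCurve ℚ) [W.IsElliptic]

/-- `2 ≠ 0` in `ℚ` (bookkeeping for the frame of `E[2]`). [folklore] -/
theorem two_ne_zero_rat : (2 : ℚ) ≠ 0 := two_ne_zero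

/-- `(4δ)² = Δ_W` in `ℚ̄` (`Δ = 16δ²`). [cite: SilvermanAEC2009, III.§1] -/
theorem four_mul_delta_sq :
    (4 * delta W two_ne_zero_rat) ^ 2 = algebraMap ℚ (AlgebraicClosure ℚ) W.Δ := by
  have h : algebraMap ℚ (AlgebraicClosure ℚ) W.Δ = 16 * delta W two_ne_zero_rat ^ 2 := algebraMap_Δ W two_ne_zero_rat
  rw [h]; ring

/-- `4δ ∈ ℚ(W[2])`. [cite: DokchitserDokchitserMathZ2012, Theorem (1), proof (ℚ(E[2]) ⊃ ℚ(√Δ))] -/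
theorem four_mul_delta_mem_divisionField : 4 * delta W two_ne_zero_rat ∈ W.divisionField 2 := by
  refine mul_mem ?_ (delta_mem_divisionField W two_ne_zero_rat)
  exact_mod_cast (W.divisionField 2).natCast_mem 4

/-- `X² − Δ_W` is the minimal polynomial of `4δ` when `Δ_W < 0` (no rational root). [folklore] -/
theorem minpoly_four_mul_delta (hΔ : W.Δ < 0) :
    minpoly ℚ (4 * delta W two_ne_zero_rat) = X ^ 2 - C W.Δ := by
  have hmonic : (X ^ 2 - C W.Δ : ℚ[X]).Monic := monic_X_pow_sub_C W.Δ two_ne_zero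
  have hdeg : (X ^ 2 - C W.Δ : ℚ[X]).natDegree = 2 := natDegree_X_pow_sub_C
  have hirr : Irreducible (X ^ 2 - C W.Δ : ℚ[X]) := by
    refine Polynomial.irreducible_of_degree_le_three_of_not_isRoot (by rw [hdeg]; decide) fun r hr ↦ ?_
    rw [IsRoot, eval_sub, eval_pow, eval_X, eval_C, sub_eq_zero] at hr
    nlinarith [sq_nonneg r]
  symm
  refine minpoly.eq_of_irreducible_of_monic hirr ?_ hmonic
  rw [map_sub, map_pow, aeval_X, aeval_C, sub_eq_zero]
  exact four_mul_delta_sq W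

/-- **`[ℚ(√Δ_W) : ℚ] = 2`** for `Δ_W < 0`. [folklore] -/
theorem finrank_resolvent_eq_two (hΔ : W.Δ < 0) :
    Module.finrank ℚ ℚ⟮4 * delta W two_ne_zero_rat⟯ = 2 := by
  have h := IntermediateField.adjoin.finrank (K := ℚ) ((AlgebraicClosure.isAlgebraic ℚ).isAlgebraic (4 * delta W two_ne_zero_rat)).isIntegral
  have hmin : (minpoly ℚ (4 * delta W two_ne_zero_rat)).natDegree = 2 := by
    rw [minpoly_four_mul_delta W hΔ, natDegree_X_pow_sub_C]
  exact h.trans hmin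

/-- **`ℚ(√Δ_W)` has no real embedding** for `Δ_W < 0`: a ring map to `ℝ` would produce a real number of square `Δ_W`. [folklore] -/
theorem isEmpty_ringHom_resolvent_real (hΔ : W.Δ < 0) :
    IsEmpty (ℚ⟮4 * delta W two_ne_zero_rat⟯ →+* ℝ) := by
  refine ⟨fun f ↦ ?_⟩
  set d : ℚ⟮4 * delta W two_ne_zero_rat⟯ :=
    ⟨4 * delta W two_ne_zero_rat, IntermediateField.mem_adjoin_simple_self ℚ _⟩ with hd
  have hd2 : d ^ 2 = algebraMap ℚ ℚ⟮4 * delta W two_ne_zero_rat⟯ W.Δ := by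
    apply Subtype.ext
    rw [SubmonoidClass.coe_pow]
    exact (four_mul_delta_sq W).trans (IsScalarTower.algebraMap_apply ℚ ℚ⟮4 * delta W two_ne_zero_rat⟯ (AlgebraicClosure ℚ) W.Δ)
  have h := congrArg f hd2
  rw [map_pow] at h
  have hq : f (algebraMap ℚ ℚ⟮4 * delta W two_ne_zero_rat⟯ W.Δ) = (W.Δ : ℝ) := eq_ratCast (f.comp (algebraMap ℚ _)) W.Δ
  rw [hq] at h
  have : (0 : ℝ) ≤ (W.Δ : ℝ) := by rw [← h]; exact sq_nonneg _
  exact absurd this (by exact_mod_cast not_le.mpr hΔ)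

end Resolvent

/-! ## §4. The registered stub `stub_resolventOfDivisionFieldTwo` of line `resolvent-elliptic-units` -/

/-- Restriction to a normal subfield `L ⊆ k̄` acts on `L` as the automorphism does on `k̄`. [folklore] -/
theorem coe_absRestrictNormalHom_apply {k : Type u} [Field k] (L : IntermediateField k (AlgebraicClosure k)) [Normal k L]
    (g : absoluteGaloisGroup k) (x : L) :
    ((absRestrictNormalHom L g x : L) : AlgebraicClosure k) = g • (x : AlgebraicClosure k) :=
  AlgEquiv.restrictNormal_commutes (absoluteGaloisGroup.toAlgEquiv k g) L x

/-- Restriction `Γ_ℚ → Gal(L/ℚ)` is onto for a normal `L ⊆ ℚ̄`. [folklore] -/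
theorem absRestrictNormalHom_surjective {k : Type u} [Field k] (L : IntermediateField k (AlgebraicClosure k)) [Normal k L] :
    Function.Surjective (absRestrictNormalHom L) := fun g ↦ by
  obtain ⟨σ, hσ⟩ := AlgEquiv.restrictNormalHom_surjective (AlgebraicClosure k) g
  exact ⟨(absoluteGaloisGroup.toAlgEquiv k).symm σ, hσ⟩

/-- **`ResolventOfDivisionFieldTwo`** (= `stub_resolventOfDivisionFieldTwo` of
`Cruxes/SignedMuSeedAtTwoPlus/Lines/resolvent_elliptic_units.lean`, the line's `def ResolventOfDivisionFieldTwo` unfolded verbatim):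
on the habitat⁺ (only `Δ_W < 0` is used) `ℚ(W[2])/ℚ` is finite Galois and contains the imaginary quadratic RESOLVENT
`K = ℚ(√Δ_W) = ℚ(4δ)` over which it is abelian: two automorphisms fixing `K` fix `δ`, so are even on `{T₀, T₁, T₂}`, so their
commutator acts trivially on `E[2]`, hence on `ℚ(W[2])`. [cite: DokchitserDokchitserMathZ2012, Theorem (1), proof]
[cite: SilvermanAEC2009, VIII.§1] -/
theorem resolventOfDivisionFieldTwo :
    ∀ (W : WeierstrassCurve ℚ) [W.IsElliptic] [W.IsGloballyMinimal], ¬ W.HasCM → W.analyticRank = 0 →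
      GoodSS W 2 → W.frobeniusTrace 2 = 0 → W.Δ < 0 →
      FiniteDimensional ℚ (W.divisionField 2) ∧ IsGalois ℚ (W.divisionField 2) ∧
        ∃ K : IntermediateField ℚ (AlgebraicClosure ℚ), K ≤ W.divisionField 2 ∧ Module.finrank ℚ K = 2 ∧
          IsEmpty (K →+* ℝ) ∧
          ∀ σ τ : (W.divisionField 2) ≃ₐ[ℚ] (W.divisionField 2),
            (∀ x : W.divisionField 2, (x : AlgebraicClosure ℚ) ∈ K → σ x = x) →
            (∀ x : W.divisionField 2, (x : AlgebraicClosure ℚ) ∈ K → τ x = x) → σ * τ = τ * σ := by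
  intro W _ _ _hCM _hr _hss _ha2 hΔ
  haveI : IsGalois ℚ (W.divisionField 2) := W.isGalois_divisionField 2
  refine ⟨W.finiteDimensional_divisionField 2, W.isGalois_divisionField 2, ℚ⟮4 * delta W two_ne_zero_rat⟯,
    IntermediateField.adjoin_simple_le_iff.mpr (four_mul_delta_mem_divisionField W), finrank_resolvent_eq_two W hΔ,
    isEmpty_ringHom_resolvent_real W hΔ, fun σ τ hσ hτ ↦ ?_⟩
  -- lift `σ, τ` to `Γ_ℚ`
  obtain ⟨s, rfl⟩ := absRestrictNormalHom_surjective (W.divisionField 2) σ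
  obtain ⟨t, rfl⟩ := absRestrictNormalHom_surjective (W.divisionField 2) τ
  -- both fix `4δ`, hence `δ`, hence are even on the three letters
  set D : W.divisionField 2 := ⟨4 * delta W two_ne_zero_rat, four_mul_delta_mem_divisionField W⟩ with hD
  have hDmem : ((D : W.divisionField 2) : AlgebraicClosure ℚ) ∈ ℚ⟮4 * delta W two_ne_zero_rat⟯ :=
    IntermediateField.mem_adjoin_simple_self ℚ _
  have h4 : (4 : AlgebraicClosure ℚ) ≠ 0 := by norm_num
  have hfix : ∀ g : absoluteGaloisGroup ℚ, absRestrictNormalHom (W.divisionField 2) g D = D →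
      g • delta W two_ne_zero_rat = delta W two_ne_zero_rat := by
    intro g hg
    have h1 := congrArg (fun y : W.divisionField 2 ↦ (y : AlgebraicClosure ℚ)) hg
    simp only [coe_absRestrictNormalHom_apply] at h1
    change g • (4 * delta W two_ne_zero_rat) = 4 * delta W two_ne_zero_rat at h1
    rw [smul_mul', show g • (4 : AlgebraicClosure ℚ) = 4 from map_ofNat (absoluteGaloisGroup.toAlgEquiv ℚ g) 4] at h1
    exact mul_left_cancel₀ h4 h1
  have hs := sign_permGal_eq_one_of_smul_delta W two_ne_zero_rat (hfix s (hσ D hDmem))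
  have ht := sign_permGal_eq_one_of_smul_delta W two_ne_zero_rat (hfix t (hτ D hDmem))
  -- the commutator acts trivially on `E[2]`, hence restricts to `1` on `ℚ(W[2])`
  have hcomm : absRestrictNormalHom (W.divisionField 2) (s * t * s⁻¹ * t⁻¹) = 1 :=
    (W.absRestrictNormalHom_divisionField_eq_one_iff 2 _).mpr
      (commutator_smul_eq_self_of_sign_eq_one W two_ne_zero_rat hs ht)
  rw [map_mul, map_mul, map_mul, map_inv, map_inv, mul_inv_eq_one, mul_inv_eq_iff_eq_mul] at hcomm
  exact hcomm

end Summit.BirchSwinnertonDyer.BirchSwinnertonDyer.Theorems.SignedMuAtTwo.ResolventEllipticUnits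

end
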